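import Summits.Ventures.PercRepro.SevenThreeStarTable

/-!
# PercRepro — the `(7,3)` cell: the star table's exact divisions and the sum split (p3, gen 16)

Table-side helpers for the star fibre (`SevenThreeStarFibre.lean`): the guard `divOK` unpacked cell by cell
(`divOK_spec`), `C(x+3, 3) ∣ Ls` for `x ≤ 3` (`choose_dvd_Ls`), the cast of `phiTermN` (`phiTermN_cast`), and the
split of a filtered sum over the subsets of a disjoint union `N ∪ U` into pairs `(A ⊆ N, B ⊆ U)`
(`sum_filter_powerset_union`). Mathlib + the star table only.
-/

namespace PercRepro

namespace SevenThree

open Finset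

variable {α : Type*} [DecidableEq α]

/-- The table's `divOK` unpacked: exact, positive denominators on the cells with `z ≥ 2`. -/
theorem divOK_spec {tP cP l0 : ℕ} {cs : List ℕ} (hdiv : StarTable.divOK tP cP l0 cs = true) {zP zl : ℕ}
    (hzP : zP ≤ cP) (hzP0 : zP ≠ 0) (hzl : zl ≤ l0) (h2 : 2 ≤ zP + zl) :
    0 < StarTable.DstarN (tP + (cP - zP) + (l0 - zl)) cs (7 - (zP + zl)) ∧
      StarTable.DstarN (tP + (cP - zP) + (l0 - zl)) cs (7 - (zP + zl)) ∣ StarTable.Ls := by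
  unfold StarTable.divOK at hdiv
  rw [List.all_eq_true] at hdiv
  have h1 := hdiv zP (List.mem_range.2 (by omega))
  rw [Bool.or_eq_true, decide_eq_true_iff, List.all_eq_true] at h1
  rcases h1 with h1 | h1
  · exact absurd h1 hzP0
  have h3 := h1 zl (List.mem_range.2 (by omega))
  rw [Bool.or_eq_true, decide_eq_true_iff, decide_eq_true_iff] at h3
  rcases h3 with h3 | h3
  · omega
  · exact h3

/-- `C(x + 3, 3)` divides `Ls` for `x ≤ 3`. -/
theorem choose_dvd_Ls : ∀ x < 4, (Nat.choose (x + 3) 3 : ℤ) ∣ StarTable.Ls := by decide +kernel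

/-- `Ls > 0`. -/
theorem Ls_pos : (0 : ℤ) < StarTable.Ls := by decide

/-- The cast of `phiTermN`: `Ls / C(x+3, 3)` exactly for `x ≤ 3`. -/
theorem phiTermN_cast (x : ℕ) :
    ((StarTable.phiTermN x : ℤ) : ℚ) = if x ≤ 3 then (StarTable.Ls : ℚ) / ((Nat.choose (x + 3) 3 : ℕ) : ℚ) else 0 := by
  unfold StarTable.phiTermN
  by_cases hx : x ≤ 3
  · have hc : ((Nat.choose (x + 3) 3 : ℤ) : ℚ) ≠ 0 := by
      have := Nat.choose_pos (by omega : 3 ≤ x + 3)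
      exact_mod_cast this.ne'
    rw [if_pos hx, if_pos hx, Int.cast_div (choose_dvd_Ls x (by omega)) hc]
    push_cast
    rfl
  · rw [if_neg hx, if_neg hx, Int.cast_zero]

/-- The split of a filtered sum over the subsets of a disjoint union `N ∪ U` into pairs `(A ⊆ N, B ⊆ U)`. -/
theorem sum_filter_powerset_union {β : Type*} [AddCommMonoid β] {N U : Finset α} (hNU : Disjoint N U)
    (P : Finset α → Prop) [DecidablePred P] (f : Finset α → β) :
    ∑ C ∈ (N ∪ U).powerset.filter P, f C =
      ∑ A ∈ N.powerset, ∑ B ∈ U.powerset.filter (fun B => P (A ∪ B)), f (A ∪ B) := by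
  rw [← Finset.sum_fiberwise_of_maps_to (g := fun C => C ∩ N) (t := N.powerset)]
  · apply Finset.sum_congr rfl
    intro A hA
    rw [Finset.mem_powerset] at hA
    apply Finset.sum_nbij' (fun C => C ∩ U) (fun B => A ∪ B)
    · intro C hC
      rw [Finset.mem_filter, Finset.mem_filter, Finset.mem_powerset] at hC
      rw [Finset.mem_filter, Finset.mem_powerset]
      obtain ⟨⟨hCNU, hPC⟩, hCN⟩ := hC
      refine ⟨Finset.inter_subset_right, ?_⟩
      have : A ∪ C ∩ U = C := by
        rw [← hCN, ← Finset.inter_union_distrib_left]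
        exact Finset.inter_eq_left.2 hCNU
      rw [this]
      exact hPC
    · intro B hB
      rw [Finset.mem_filter, Finset.mem_powerset] at hB
      rw [Finset.mem_filter, Finset.mem_filter, Finset.mem_powerset]
      obtain ⟨hBU, hPB⟩ := hB
      refine ⟨⟨Finset.union_subset_union hA hBU, hPB⟩, ?_⟩
      rw [Finset.union_inter_distrib_right, Finset.disjoint_iff_inter_eq_empty.1 (hNU.symm.mono_left hBU),
        Finset.union_empty]
      exact Finset.inter_eq_left.2 hA
    · intro C hC
      rw [Finset.mem_filter, Finset.mem_filter, Finset.mem_powerset] at hC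
      obtain ⟨⟨hCNU, -⟩, hCN⟩ := hC
      show A ∪ C ∩ U = C
      rw [← hCN, ← Finset.inter_union_distrib_left]
      exact Finset.inter_eq_left.2 hCNU
    · intro B hB
      rw [Finset.mem_filter, Finset.mem_powerset] at hB
      show (A ∪ B) ∩ U = B
      rw [Finset.union_inter_distrib_right, Finset.disjoint_iff_inter_eq_empty.1 (hNU.mono_left hA),
        Finset.empty_union]
      exact Finset.inter_eq_left.2 hB.1
    · intro C hC
      rw [Finset.mem_filter, Finset.mem_filter, Finset.mem_powerset] at hC
      obtain ⟨⟨hCNU, -⟩, hCN⟩ := hC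
      show f C = f (A ∪ C ∩ U)
      congr 1
      rw [← hCN, ← Finset.inter_union_distrib_left]
      exact (Finset.inter_eq_left.2 hCNU).symm
  · intro C hC
    rw [Finset.mem_filter, Finset.mem_powerset] at hC
    rw [Finset.mem_powerset]
    exact Finset.inter_subset_right
end SevenThree

end PercRepro
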